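/-
Copyright (c) 2026 the pub-hodgecm-mathlib formalisation cell (harness21).  Prover seat hodgecm-mathlib-LD1-p02 (g0), organ payer of half-A
line LD1 (dealer LD1-plan (g0), deal (K) 2026-09-02T04:23:11Z ∕ 04:24:00Z; LD-ref1 hygiene verdict 04:31:16Z), 2026-09-02.
THEOREMS ONLY (no definition, no named fact, no `sorry`, no instance, no notation).  `--supports stmt-HodgeConjecture-24832 --as helper`.
-/
import Summits.HodgeConjecture.HodgeConjecture.Theorems.F0LD2ArchSignAt
import Summits.HodgeConjecture.HodgeConjecture.Theorems.HLiu418E2ArchOrthHolCM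
import Literature.NumberTheory.Automorphic.UnitaryGroupLevelTransport
import HarnessLib

/-!
# [Liu2021, Lem. D.2 (3)] at the place of `ι` for ANY PHASE of `σ(t)`: the two-sided sign theorem without `Im σ(t) = 0`, and the RELATIVE
# corollary for line LD1's organ (L) with NO binder on `t` (deal (K) of LD1-plan (g0); LD-ref1's hygiene verdict 2026-09-02T04:31:16Z)

Cell hodgecm-mathlib FLOOR 0, programme P6, half-A line LD (crux `hLiu418` = `stmt-HodgeConjecture-24832`); organs C₂at′ (LD2) and (L) step (L-Dι) (LD1).
Namespace `Summit.HodgeConjecture.HodgeConjecture.Cruxes.HLiu418.F0LD2ArchSignAtAnyPhase`.  WHY: the unsigned prefix `(t : L) (ht) (g) (hg)` of #73 ∕ organ (L)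
does not give `c̄ t = t`, so ★ `F0LD1ArchSignRelative.im_mul_im_pos_of_meets_of_hol₂` (binder `Im ι(t) = 0`) is not consumable by the (L) closer.  The only
non-cosmetic use of `Im σ(t) = 0` in ★ `F0LD2ArchSignAt.re_mul_im_lt_zero_of_meets_of_hol₂` was hermitian-ness of `σ(H)` for the frame-to-frame unitary; §1
removes it: with `M₁ := σ(t•H)` (hermitian for every `t`, ★ `E2ArchOrthHolCM.isHermitian_map_smul`), `s := σ(t)⁻¹`, `x := (t⁻¹ + c̄ t⁻¹)/2` (`σ x = Re s`), the matrix
`J′ := x • (t • H)` has `σJ′ = (Re s) • M₁` hermitian, `U(σJ′) = U(σH)` (★ `unitaryGroupOfForm_smul_of_isUnit`), and every cone frame of `H` is one of `J′` with the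
same vectors; `Re s ≠ 0` comes from the cone frame (`𝔣.v₀_mem`).
* §1 `exists_embedding_eq_re`, `re_star_dotProduct_mulVec_map`, `re_inv_embedding_ne_zero_of_coneFrame`, **`exists_archLocal_frame_to_frame_of_frame`**;
* §2 **`re_mul_im_lt_zero_of_meets_of_hol₂'`** — ★ §2 of `F0LD2ArchSignAt` MINUS the binder `Im σ_{w₀}(t) = 0` (frame sign read as `d_p · Re((σ t)⁻¹)`);
* §3 **`im_mul_im_pos_of_meets_of_hol₂'`** — the (L-Dι) corollary over organ (L)'s prefix Γ ONLY: «same `t`, both hol₂ ⇒ `0 < Im e♮(a′δ′) · Im e♮(a″δ′)`».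

HONEST SCOPE.  Helpers (`--supports`); organs, line and HC_CM are NOT proved here — HC_CM stays conditional on the remaining printed inputs (hLiu418, h413) until
rung 0 closes.  References: [Liu2021] arXiv:2102.11518, App. D Lem. D.2 (3) (p. 127 L40 – p. 128 L2), proof of Prop. D.4 (1) (p. 131 L27–34); [KonnoKonno2007]
Thm. 5.4; [Jacobson] *Basic Algebra I*, Ch. V §7 pp. 150–151, §11 p. 162; [BorelJacquet1979] §4.1, §4.6.
-/

set_option autoImplicit false
set_option linter.dupNamespace false

noncomputable section

open NumberField NumberField.InfinitePlace MeasureTheory IsDedekindDomain Matrix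
open scoped Matrix ComplexOrder ENNReal TensorProduct SchwartzMap Classical InnerProductSpace ComplexConjugate

namespace Summit.HodgeConjecture.HodgeConjecture.Cruxes.HLiu418.F0LD2ArchSignAtAnyPhase

open _root_.MeasureTheory
open Literature.NumberTheory.Automorphic Literature.NumberTheory.Automorphic.UnitaryGroup
open Literature.NumberTheory.Automorphic.UnitaryGroup.CotangentForms (toQuotFun)
open Literature.NumberTheory.Automorphic.UnitaryCurveForms
open Literature.NumberTheory.Automorphic.IdeleClassGroup
open Literature.NumberTheory.Automorphic.Liu2021 Literature.NumberTheory.Automorphic.Liu2021.CinfThetaTorus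
open Literature.NumberTheory.Automorphic.Liu2021.Def411WeilCarriers Literature.NumberTheory.Automorphic.Liu2021.Def411WeilCarriersDoubling
open Literature.NumberTheory.GelbartRogawski1991 Literature.NumberTheory.GelbartRogawski1991.UnitaryDualPair
open Literature.NumberTheory.GelbartRogawski1991.GRConstruction Literature.NumberTheory.Weil1964 Literature.RepresentationTheory.Liu2021
open Literature.RepresentationTheory.HeisenbergGroup Literature.Analysis.SegalBargmann
open Literature.AlgebraicGeometry.ShimuraVarieties Literature.Geometry.ComplexHyperbolic
open Summit.HodgeConjecture.HodgeConjecture.Cruxes.HLiu418.F0LD1ThetaTransportKit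
open Summit.HodgeConjecture.HodgeConjecture.Cruxes.HLiu418.F0LD2FrameTransportPin (continuous_of_pin mem_range_toAdelic_of_pin)
open Summit.HodgeConjecture.HodgeConjecture.Cruxes.HLiu418.F0LD2ScaledFrameCone Summit.HodgeConjecture.HodgeConjecture.Cruxes.HLiu418.F0LD2ConeTorusCovariance
open Summit.HodgeConjecture.HodgeConjecture.Cruxes.HLiu418.F0LD2ThetaCyclicity Summit.HodgeConjecture.HodgeConjecture.Cruxes.HLiu418.F0LD2ThetaTorusEigenclass
open Summit.HodgeConjecture.HodgeConjecture.Cruxes.HLiu418.F0LD2ThetaTensorCLM (exists_clm_comp_toLp_lineThetaLift_tmul)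
open Summit.HodgeConjecture.HodgeConjecture.Cruxes.HLiu418.F0LD2CurveHolTestVector (exists_toLp_ne_zero_of_isHolCotangentAt₂)
open Summit.HodgeConjecture.HodgeConjecture.Cruxes.HLiu418.F0LD2ArchSignAt
open Summit.HodgeConjecture.HodgeConjecture.Cruxes.HLiu418.E2ArchOrthHolCM (isHermitian_map_smul map_smul_eq)

/-! ## §1 The frame-to-frame unitary for ANY phase of `σ(t)` -/

section Frame

variable (L : Type) [Field L] [NumberField L] [IsCMField L] (H : Matrix (Fin 2) (Fin 2) L) (dV : Fin 2 → L)
  (hdV : ∀ i, IsCMField.complexConj L (dV i) = dV i) (t : L) (ht : t ≠ 0) (g : GL (Fin 2) L)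
  (hg : formCongr ((IsCMField.complexConj L : L ≃ₐ[↥(maximalRealSubfield L)] L) : L →+* L) g (t • H) = Matrix.diagonal dV)
  (w : {w : InfinitePlace L // w.IsComplex})

/-- **An element of `L` whose `σ`-value is `Re σ(y)`**: `x = (y + c̄ y)/2` (`σ ∘ c̄ = conj ∘ σ`, ★ `embedding_cmConjRingHom`). [folklore] -/
theorem exists_embedding_eq_re (σ : L →+* ℂ) (y : L) : ∃ x : L, σ x = ((σ y).re : ℂ) := by
  refine ⟨(2 : L)⁻¹ * (y + cmConjRingHom L y), ?_⟩
  rw [map_mul, map_inv₀, map_ofNat, map_add, embedding_cmConjRingHom, Complex.add_conj]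
  push_cast
  ring

omit [NumberField L] [IsCMField L] in
/-- `Re(v⋆ (c • M) u) = Re(c · (v⋆ M u))`. [folklore] -/
theorem star_dotProduct_smul_mulVec (c : ℂ) (M : Matrix (Fin 2) (Fin 2) ℂ) (v u : Fin 2 → ℂ) :
    star v ⬝ᵥ ((c • M) *ᵥ u) = c * (star v ⬝ᵥ (M *ᵥ u)) := by
  rw [Matrix.smul_mulVec, dotProduct_smul, smul_eq_mul]

include hdV ht hg in
/-- **`σ(H) = σ(t)⁻¹ • σ(t • H)` with `σ(t • H)` hermitian**, so `Re(v⋆ σ(H) v) = Re(σ(t)⁻¹) · (v⋆ σ(t•H) v)` (the latter value is real).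
[cite: Jacobson, Ch. V §7 pp. 150–151] -/
theorem re_star_dotProduct_mulVec_map (v : Fin 2 → ℂ) :
    (star v ⬝ᵥ (H.map w.1.embedding *ᵥ v)).re =
      ((w.1.embedding t)⁻¹).re * (star v ⬝ᵥ ((t • H).map w.1.embedding *ᵥ v)).re := by
  have hM := isHermitian_map_smul H dV hdV t g hg w.1.embedding
  have hH : H.map w.1.embedding = (w.1.embedding t)⁻¹ • (t • H).map w.1.embedding := by
    rw [map_smul_eq, smul_smul, inv_mul_cancel₀ ((map_ne_zero _).2 ht), one_smul]
  have hr := dotProduct_mulVec_self_eq_re hM v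
  rw [hH, star_dotProduct_smul_mulVec]
  conv_lhs => rw [hr]
  rw [Complex.re_mul_ofReal]

include hdV ht hg in
/-- **A cone frame forces `Re(σ(t)⁻¹) ≠ 0`**: `Re(v₀⋆ σ(H) v₀) = Re(σ(t)⁻¹) · (v₀⋆ σ(t•H) v₀) < 0`. [cite: Jacobson, Ch. V §7 pp. 150–151] -/
theorem re_inv_embedding_ne_zero_of_coneFrame (𝔣 : ConeFrame L H w) : ((w.1.embedding t)⁻¹).re ≠ 0 := by
  intro h0
  have h := mem_negCone_iff.1 𝔣.v₀_mem
  rw [re_star_dotProduct_mulVec_map L H dV hdV t ht g hg w, h0, zero_mul] at h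
  exact lt_irrefl _ h

include hdV ht hg in
/-- **FRAME TO FRAME FOR ANY PHASE OF `σ(t)`.**  For two cone frames `𝔣`, `𝔣′` of `H` at `w` (no hermitian hypothesis on `σ(H)`; the scaled frame `hg` and
`c̄ dV = dV` instead) there is `h ∈ U(σ_w H)(ℂ)` with `h t₀ = α t₀′`, `h v₀ = β v₀′`, `α, β ≠ 0`: the frames are cone frames of the `c̄`-hermitian
`J′ := x • (t • H)` with `σ x = Re(σ(t)⁻¹)` (same vectors), `U(σ_w J′) = U(σ_w H)` (★ `unitaryGroupOfForm_smul_of_isUnit`), and ★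
`exists_archLocal_frame_to_frame` applies to `J′`. [cite: Jacobson, Ch. V §7 pp. 150–151; §11 p. 162] -/
theorem exists_archLocal_frame_to_frame_of_frame (𝔣 𝔣' : ConeFrame L H w) :
    ∃ (h : archLocal L 2 H w) (α β : ℂ), α ≠ 0 ∧ β ≠ 0 ∧
      ((h : GL (Fin 2) ℂ) : Matrix (Fin 2) (Fin 2) ℂ) *ᵥ 𝔣.t₀ = α • 𝔣'.t₀ ∧
      ((h : GL (Fin 2) ℂ) : Matrix (Fin 2) (Fin 2) ℂ) *ᵥ 𝔣.v₀ = β • 𝔣'.v₀ := by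
  have hM := isHermitian_map_smul H dV hdV t g hg w.1.embedding
  have hs0 : (w.1.embedding t)⁻¹ ≠ 0 := inv_ne_zero ((map_ne_zero _).2 ht)
  have hrs : ((w.1.embedding t)⁻¹).re ≠ 0 := re_inv_embedding_ne_zero_of_coneFrame L H dV hdV t ht g hg w 𝔣
  obtain ⟨x, hx⟩ := exists_embedding_eq_re L w.1.embedding t⁻¹
  rw [map_inv₀] at hx
  have hH : H.map w.1.embedding = (w.1.embedding t)⁻¹ • (t • H).map w.1.embedding := by
    rw [map_smul_eq, smul_smul, inv_mul_cancel₀ ((map_ne_zero _).2 ht), one_smul]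
  have hJ'σ : (x • (t • H)).map w.1.embedding = ((((w.1.embedding t)⁻¹).re : ℝ) : ℂ) • (t • H).map w.1.embedding := by
    rw [map_smul_eq, hx]
  have hJ' : ((x • (t • H)).map w.1.embedding).IsHermitian := by
    rw [hJ'σ]
    show (_ : Matrix (Fin 2) (Fin 2) ℂ)ᴴ = _
    rw [Matrix.conjTranspose_smul, hM.eq, Complex.star_def, Complex.conj_ofReal]
  have hU : archLocal L 2 (x • (t • H)) w = archLocal L 2 H w := by
    show unitaryGroupOfForm (starRingEnd ℂ) ((x • (t • H)).map w.1.embedding) = unitaryGroupOfForm (starRingEnd ℂ) (H.map w.1.embedding)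
    rw [hJ'σ, hH, unitaryGroupOfForm_smul_of_isUnit _ (isUnit_iff_ne_zero.2 (Complex.ofReal_ne_zero.2 hrs)),
      unitaryGroupOfForm_smul_of_isUnit _ (isUnit_iff_ne_zero.2 hs0)]
  have hre : ∀ v u : Fin 2 → ℂ, (star v ⬝ᵥ ((x • (t • H)).map w.1.embedding *ᵥ u)) =
      ((((w.1.embedding t)⁻¹).re : ℝ) : ℂ) * (star v ⬝ᵥ ((t • H).map w.1.embedding *ᵥ u)) := fun v u => by
    rw [hJ'σ, star_dotProduct_smul_mulVec]
  have hreH : ∀ v u : Fin 2 → ℂ, (star v ⬝ᵥ (H.map w.1.embedding *ᵥ u)) =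
      (w.1.embedding t)⁻¹ * (star v ⬝ᵥ ((t • H).map w.1.embedding *ᵥ u)) := fun v u => by
    rw [hH, star_dotProduct_smul_mulVec]
  have hself : ∀ v : Fin 2 → ℂ, (star v ⬝ᵥ ((x • (t • H)).map w.1.embedding *ᵥ v)).re = (star v ⬝ᵥ (H.map w.1.embedding *ᵥ v)).re :=
    fun v => by
    rw [hre, hreH, dotProduct_mulVec_self_eq_re hM v, Complex.re_mul_ofReal, Complex.re_mul_ofReal, Complex.ofReal_re]
  have horth : ∀ 𝔢 : ConeFrame L H w, star 𝔢.t₀ ⬝ᵥ ((x • (t • H)).map w.1.embedding *ᵥ 𝔢.v₀) = 0 := fun 𝔢 => by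
    have h1 := 𝔢.orth
    rw [hreH] at h1
    rw [hre, (mul_eq_zero.1 h1).resolve_left hs0, mul_zero]
  let 𝔢 : ConeFrame L (x • (t • H)) w := ⟨𝔣.v₀, 𝔣.t₀, by rw [mem_negCone_iff, hself]; exact mem_negCone_iff.1 𝔣.v₀_mem,
    by rw [hself]; exact 𝔣.t₀_pos, horth 𝔣⟩
  let 𝔢' : ConeFrame L (x • (t • H)) w := ⟨𝔣'.v₀, 𝔣'.t₀, by rw [mem_negCone_iff, hself]; exact mem_negCone_iff.1 𝔣'.v₀_mem,
    by rw [hself]; exact 𝔣'.t₀_pos, horth 𝔣'⟩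
  obtain ⟨h', α, β, hα, hβ, hht, hhv⟩ := exists_archLocal_frame_to_frame hJ' 𝔢 𝔢'
  exact ⟨⟨h'.1, hU ▸ h'.2⟩, α, β, hα, hβ, hht, hhv⟩

end Frame

/-! ## §2 The two-sided sign theorem for any phase of `σ(t)` -/

set_option maxHeartbeats 4000000 in
-- (the organ's binder list and the theta/frame telescopes are large; every step is a named ★ lemma)
/-- **[Liu2021, Lem. D.2 (3)] AT RANK 2, CONE MODEL, PINNED TRANSPORT, TWO-SIDED, ANY PHASE OF `σ(t)`** (★ `re_mul_im_lt_zero_of_meets_of_hol₂`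
without its binder `Im σ_{w₀}(t) = 0`): `ᵗ(c̄ g)(t•H)g = diag dV`, `w₀ = cmPlaceOver L v₀`,
`Re(σ_{w₀}(dV p₋)/σ_{w₀}(t)) < 0 < Re(σ_{w₀}(dV p₊)/σ_{w₀}(t))`; if `P` (compact quotient) MEETS the theta lift from `⟨a′⟩` at `μ′` along the pinned `ιA` and is
HOLOMORPHIC-COTANGENT at `w₀` for a cone frame `𝔣`, then `Re σ_{w₀}(t) · Im σ_{w₀}(a′·(2·imagUnit L)⁻¹) < 0` (road: module docstring; every input ★).
[cite: Liu2021, App. D Lem. D.2 (3) (p. 127 L40 – p. 128 L2); proof of Prop. 4.13 Case 1 (l. 2137–2141, p. 48)] [cite: KonnoKonno2007, Thm. 5.4] [cite: Borel1997, §5.13–§5.14] -/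
theorem re_mul_im_lt_zero_of_meets_of_hol₂' (L : Type) [Field L] [NumberField L] [IsCMField L] (H : Matrix (Fin 2) (Fin 2) L)
    (dV : Fin 2 → L) (hdV : ∀ i, IsCMField.complexConj L (dV i) = dV i) (hdV0 : ∀ i, dV i ≠ 0)
    (t : L) (ht : t ≠ 0) (g : GL (Fin 2) L)
    (hg : formCongr ((IsCMField.complexConj L : L ≃ₐ[↥(maximalRealSubfield L)] L) : L →+* L) g (t • H) = Matrix.diagonal dV)
    (v₀ : {v : InfinitePlace (↥(maximalRealSubfield L)) // v.IsReal}) (w₀ : {w : InfinitePlace L // w.IsComplex}) (hw₀ : w₀ = cmPlaceOver L v₀)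
    (pm pp : Fin 2) (hne : pp ≠ pm)
    (hm : (w₀.1.embedding (dV pm) * (w₀.1.embedding t)⁻¹).re < 0) (hp : 0 < (w₀.1.embedding (dV pp) * (w₀.1.embedding t)⁻¹).re)
    [CompactSpace (adelicGroupData (↥(maximalRealSubfield L)) L (IsCMField.complexConj L) 2 H).automorphicQuotient]
    (𝔣 : ConeFrame L H w₀)
    {μA : Measure (adelicGroupData (↥(maximalRealSubfield L)) L (IsCMField.complexConj L) 2 H).automorphicQuotient}
    [(adelicGroupData (↥(maximalRealSubfield L)) L (IsCMField.complexConj L) 2 H).IsAutomorphicMeasure μA]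
    {n' : ℕ} (e₁ : Fin 2 × Fin 1 ≃ Fin n')
    (ιA : (adelicGroupData (↥(maximalRealSubfield L)) L (IsCMField.complexConj L) 2 H).Adelic →*
      ↥(UnitaryGroup.adelic (↥(maximalRealSubfield L)) L (IsCMField.complexConj L) 2 (Matrix.diagonal dV)))
    (hιA : ∀ k, ((ιA k : ↥(UnitaryGroup.adelic (↥(maximalRealSubfield L)) L (IsCMField.complexConj L) 2 (Matrix.diagonal dV))) :
          GL (Fin 2) (AdeleRing (𝓞 L) L)) =
        (toAdeleGL L g)⁻¹ * adelicVal (↥(maximalRealSubfield L)) L (IsCMField.complexConj L) 2 H k * toAdeleGL L g)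
    [CompactSpace (↥(UnitaryGroup.adelic (↥(maximalRealSubfield L)) L (IsCMField.complexConj L) 2 (Matrix.diagonal dV)) ⧸
        (UnitaryGroup.toAdelic (↥(maximalRealSubfield L)) L (IsCMField.complexConj L) 2 (Matrix.diagonal dV)).range)]
    (P : DiscreteAutomorphicRep (adelicGroupData (↥(maximalRealSubfield L)) L (IsCMField.complexConj L) 2 H) μA)
    (μ' : Literature.NumberTheory.Automorphic.IdeleClassGroup L →ₜ* Circle) (hμ' : IsConjugateSymplectic L μ')
    (a' : (↥(maximalRealSubfield L))ˣ)
    (hmeets : MeetsThetaLiftFromLine L 2 H e₁ dV hdV hdV0 P μ' hμ' a' ιA)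
    (hhol : P.IsHolCotangentAt₂ (IsCMField.complexConj_ne_one L) (UnitaryGroup.complexConj_smul_infinitePlace L) w₀ 𝔣) :
    (w₀.1.embedding t).re * (w₀.1.embedding (algebraMap (↥(maximalRealSubfield L)) L a' * (2 * imagUnit L)⁻¹)).im < 0 := by
  subst hw₀
  letI : MeasurableSpace (↥(UnitaryGroup.adelic (↥(maximalRealSubfield L)) L (IsCMField.complexConj L) 1 (JW (↥(maximalRealSubfield L)) L a')) ⧸
      (UnitaryGroup.toAdelic (↥(maximalRealSubfield L)) L (IsCMField.complexConj L) 1 (JW (↥(maximalRealSubfield L)) L a')).range) := borel _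
  haveI : BorelSpace (↥(UnitaryGroup.adelic (↥(maximalRealSubfield L)) L (IsCMField.complexConj L) 1 (JW (↥(maximalRealSubfield L)) L a')) ⧸
      (UnitaryGroup.toAdelic (↥(maximalRealSubfield L)) L (IsCMField.complexConj L) 1 (JW (↥(maximalRealSubfield L)) L a')).range) := ⟨rfl⟩
  haveI := normal_range_toAdelic_JW L a'
  have hιA' : Continuous ιA ∧ ∀ ⦃γ : (adelicGroupData (↥(maximalRealSubfield L)) L (IsCMField.complexConj L) 2 H).Adelic⦄,
      γ ∈ (UnitaryGroup.toAdelic (↥(maximalRealSubfield L)) L (IsCMField.complexConj L) 2 H).range →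
        ιA γ ∈ (UnitaryGroup.toAdelic (↥(maximalRealSubfield L)) L (IsCMField.complexConj L) 2 (Matrix.diagonal dV)).range :=
    ⟨continuous_of_pin L 2 H dV g ιA hιA, fun _ hγ => mem_range_toAdelic_of_pin L 2 H dV t ht g hg ιA hιA hγ⟩
  let d : Fin 2 → ℝ := fun p =>
    embedding_of_isReal v₀.2 (⟨dV p, (IsCMField.complexConj_eq_self_iff (K := L) (dV p)).1 (hdV p)⟩ : ↥(maximalRealSubfield L))
  have hd : ∀ p, (cmPlaceOver L v₀).1.embedding (dV p) = ((d p : ℝ) : ℂ) := fun p => embedding_cmPlaceOver_dV L dV hdV v₀ p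
  -- the phase-robust frame sign `τi = Re((σ t)⁻¹)`
  set τi : ℝ := (((cmPlaceOver L v₀).1.embedding t)⁻¹).re with hτi
  have hσt0 : (cmPlaceOver L v₀).1.embedding t ≠ 0 := (map_ne_zero _).2 ht
  have hre : ∀ p, ((cmPlaceOver L v₀).1.embedding (dV p) * ((cmPlaceOver L v₀).1.embedding t)⁻¹).re = d p * τi := fun p => by
    rw [hd, Complex.re_ofReal_mul]
  have hmR : d pm * τi < 0 := by rw [← hre]; exact hm
  have hpR : 0 < d pp * τi := by rw [← hre]; exact hp
  -- the cone frame of the columns, frame to frame (ANY phase of `σ t`, §1)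
  obtain ⟨𝔣', h𝔣'v, h𝔣't⟩ := exists_coneFrame_of_columns L H dV t ht g hg (cmPlaceOver L v₀) pm pp hne hm hp
  obtain ⟨h, αh, βh, hα, hβ0, hht, hhv⟩ := exists_archLocal_frame_to_frame_of_frame L H dV hdV t ht g hg (cmPlaceOver L v₀) 𝔣 𝔣'
  obtain ⟨fh, hfh, hfm, hfmem, hfne⟩ := exists_toLp_ne_zero_of_isHolCotangentAt₂ (μ := μA) P hhol
  have hRU := (adelicGroupData (↥(maximalRealSubfield L)) L (IsCMField.complexConj L) 2 H).isUnitary_rightRegular μA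
  obtain ⟨wf, hwf⟩ : ∃ wf, wf = (adelicGroupData (↥(maximalRealSubfield L)) L (IsCMField.complexConj L) 2 H).rightRegular μA
      (UnitaryGroup.adelicSingle (↥(maximalRealSubfield L)) L (IsCMField.complexConj L) 2 H (IsCMField.complexConj_ne_one L)
        (UnitaryGroup.complexConj_smul_infinitePlace L) (cmPlaceOver L v₀) h) (hfm.toLp _) := ⟨_, rfl⟩
  have hwmem : wf ∈ P.space.toSubmodule := by rw [hwf]; exact P.space.apply_mem_toSubmodule _ hfmem
  have hwne : wf ≠ 0 := fun h0 => hfne (by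
    rw [← norm_eq_zero, ← hRU.norm_map (UnitaryGroup.adelicSingle (↥(maximalRealSubfield L)) L (IsCMField.complexConj L) 2 H
      (IsCMField.complexConj_ne_one L) (UnitaryGroup.complexConj_smul_infinitePlace L) (cmPlaceOver L v₀) h) (hfm.toLp _), ← hwf, h0, norm_zero])
  obtain ⟨hρ, μW, hfinW, hinvW, fW, Ψ₀, hθ, hθmem, hθne⟩ := hmeets
  haveI : IsFiniteMeasure μW := hfinW
  haveI : SMulInvariantMeasure ↥(UnitaryGroup.adelic (↥(maximalRealSubfield L)) L (IsCMField.complexConj L) 1 (JW (↥(maximalRealSubfield L)) L a'))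
      (↥(UnitaryGroup.adelic (↥(maximalRealSubfield L)) L (IsCMField.complexConj L) 1 (JW (↥(maximalRealSubfield L)) L a')) ⧸
        (UnitaryGroup.toAdelic (↥(maximalRealSubfield L)) L (IsCMField.complexConj L) 1 (JW (↥(maximalRealSubfield L)) L a')).range) μW := hinvW
  obtain ⟨φ, Φf, hφ⟩ := exists_tmul_inner_starProjection_toLp_lineThetaLift_ne_zero_of_mem L 2 H e₁ dV hdV hdV0 ιA hιA' μ' hμ' a' hρ μW fW P Ψ₀
    hθmem hθne hwmem hwne
  obtain ⟨Tθ, hTθ⟩ := exists_clm_comp_toLp_lineThetaLift_tmul L 2 H e₁ dV hdV hdV0 ιA hιA' μ' hμ' a' hρ μW fW μA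
    ((innerSL ℂ wf).comp P.space.toSubmodule.starProjection) Φf
  set eV := frameV L e₁ dV hdV hdV0 (lineW L (TW (↥(maximalRealSubfield L)) a')) (complexConj_lineW L (TW (↥(maximalRealSubfield L)) a'))
    (lineW_ne_zero L (TW (↥(maximalRealSubfield L)) a') (isUnit_det_TW (↥(maximalRealSubfield L)) a')) with heV
  obtain ⟨β, hβ⟩ : ∃ β : (Fin n' × {v : InfinitePlace (↥(maximalRealSubfield L)) // v.IsReal}) →₀ ℕ,
      ⟪wf, P.space.toSubmodule.starProjection (MemLp.toLp _ (memLp_toQuotFun_lineThetaLift L 2 H e₁ dV hdV hdV0 ιA hιA' μ' hμ' a' hρ μW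
          (piSchwartzBruhatEquiv (↥(maximalRealSubfield L)) (Fin n') (follandHermite eV β ⊗ₜ Φf)) fW μA 2))⟫_ℂ ≠ 0 := by
    by_contra hall
    push Not at hall
    have hT0 : Tθ.comp ((schwartzTransport eV).symm : _ ≃L[ℂ] _).toContinuousLinearMap = 0 :=
      clm_eq_of_eq_on_hermitePi fun β' => by
        show Tθ ((schwartzTransport eV).symm (hermitePi β')) = 0
        rw [hTθ]
        exact hall β'
    apply hφ
    have h1 : Tθ φ = 0 := by
      have := congrArg (fun S => S (schwartzTransport eV φ)) hT0
      simpa using this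
    rw [hTθ] at h1
    exact h1
  have hτ : (toHeckeCharacter L μ').HasUnitaryArchType hμ'.infinityType 0 :=
    (hasUnitaryArchType_toHeckeCharacter_iff L μ' _).2 hμ'.hasInfinityType_infinityType
  have hodd : ∀ w, Odd (hμ'.infinityType w) := hμ'.odd_infinityType
  have hchar : ∀ s : Fin 2 → ℂ, (∀ p, star (s p) * s p = 1) →
      ∏ p : Fin 2, s p ^ (if 0 < signVec (cmPlaceOver L) (cmGramEntry L e₁ dV hdV (lineW L (TW (↥(maximalRealSubfield L)) a'))
          (complexConj_lineW L (TW (↥(maximalRealSubfield L)) a'))) (imagUnit L) v₀ (e₁ (p, 0))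
        then (hμ'.infinityType (cmPlaceOver L v₀).1 + 1) / 2 + β (e₁ (p, 0), v₀)
        else (hμ'.infinityType (cmPlaceOver L v₀).1 + 1) / 2 - 1 - β (e₁ (p, 0), v₀)) = s pp * (s pm)⁻¹ := by
    intro s hs
    have hs0 : ∀ p, s p ≠ 0 := fun p h0 => by have := hs p; rw [h0, mul_zero] at this; exact zero_ne_one this
    obtain ⟨u, γ, hu, hγ, hcol⟩ := exists_archLocal_torus L 2 H dV t ht g hg ιA hιA (cmPlaceOver L v₀) s hs
    have hγv : ((γ : GL (Fin 2) ℂ) : Matrix (Fin 2) (Fin 2) ℂ) *ᵥ 𝔣'.v₀ = s pm • 𝔣'.v₀ := by rw [h𝔣'v]; exact hcol pm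
    have hγt : ((γ : GL (Fin 2) ℂ) : Matrix (Fin 2) (Fin 2) ℂ) *ᵥ 𝔣'.t₀ = s pp • 𝔣'.t₀ := by rw [h𝔣't]; exact hcol pp
    have hH := rightRegular_adelicSingle_torus_smul (μ := μA) hfh hfm 𝔣' h γ hα hβ0 (hs0 pm) hht hhv hγv hγt
    rw [← hwf] at hH
    have hT := rightRegular_toLp_lineThetaLift_follandHermite_of_eq_adelicSingle L 2 H e₁ dV hdV hdV0 ιA hιA' μ' hμ' a' hρ μW fW μA v₀ hτ hodd
      s hs u hu _ hγ β Φf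
    have key := hRU.inner_map_map (UnitaryGroup.adelicSingle (↥(maximalRealSubfield L)) L (IsCMField.complexConj L) 2 H
      (IsCMField.complexConj_ne_one L) (UnitaryGroup.complexConj_smul_infinitePlace L) (cmPlaceOver L v₀) γ) wf
      (P.space.toSubmodule.starProjection (MemLp.toLp _ (memLp_toQuotFun_lineThetaLift L 2 H e₁ dV hdV hdV0 ιA hιA' μ' hμ' a' hρ μW
        (piSchwartzBruhatEquiv (↥(maximalRealSubfield L)) (Fin n') (follandHermite eV β ⊗ₜ Φf)) fW μA 2)))
    rw [hH, ← DiscreteAutomorphicRep.starProjection_rightRegular, hT, map_smul, inner_smul_left, inner_smul_right, ← mul_assoc] at key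
    have h1 := (mul_eq_right₀ hβ).1 key
    have h2 : (starRingEnd ℂ) (s pp * (s pm)⁻¹) * (s pp * (s pm)⁻¹) = 1 := by
      rw [map_mul, map_inv₀, ← Complex.star_def]
      calc star (s pp) * (star (s pm))⁻¹ * (s pp * (s pm)⁻¹) = (star (s pp) * s pp) * (star (s pm) * s pm)⁻¹ := by rw [mul_inv]; ring
        _ = 1 := by rw [hs pp, hs pm, inv_one, mul_one]
    have hne0 : (starRingEnd ℂ) (s pp * (s pm)⁻¹) ≠ 0 :=
      (map_ne_zero _).2 (mul_ne_zero (hs0 pp) (inv_ne_zero (hs0 pm)))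
    exact mul_left_cancel₀ hne0 (h1.trans h2.symm)
  have hvec := BallModel.eq_of_forall_prod_zpow_eq
    (fun p : Fin 2 => if 0 < signVec (cmPlaceOver L) (cmGramEntry L e₁ dV hdV (lineW L (TW (↥(maximalRealSubfield L)) a'))
          (complexConj_lineW L (TW (↥(maximalRealSubfield L)) a'))) (imagUnit L) v₀ (e₁ (p, 0))
        then (hμ'.infinityType (cmPlaceOver L v₀).1 + 1) / 2 + β (e₁ (p, 0), v₀)
        else (hμ'.infinityType (cmPlaceOver L v₀).1 + 1) / 2 - 1 - β (e₁ (p, 0), v₀))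
    (fun p => if p = pp then 1 else if p = pm then -1 else 0) fun s hs => by
      rw [hchar s hs, prod_zpow_two_indices s hne, zpow_one, _root_.zpow_neg, zpow_one]
  have hnp := congrFun hvec pp
  have hnm := congrFun hvec pm
  rw [if_pos rfl] at hnp
  rw [if_neg hne.symm, if_pos rfl] at hnm
  have hsign : ∀ p : Fin 2, signVec (cmPlaceOver L) (cmGramEntry L e₁ dV hdV (lineW L (TW (↥(maximalRealSubfield L)) a'))
      (complexConj_lineW L (TW (↥(maximalRealSubfield L)) a'))) (imagUnit L) v₀ (e₁ (p, 0)) =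
      d p * (embedding_of_isReal v₀.2 (a' : ↥(maximalRealSubfield L)) / deltaIm (cmPlaceOver L) (imagUnit L) v₀) := fun p => by
    rw [signVec_cmGramEntry_eq, Equiv.symm_apply_apply, mul_div_assoc]
    rfl
  have hδ0 : deltaIm (cmPlaceOver L) (imagUnit L) v₀ ≠ 0 :=
    deltaIm_ne_zero (IsCMField.complexConj_ne_one L) (cmPlaceOver_smul L) (complexConj_imagUnit L) (imagUnit_ne_zero L) v₀
  have hκ : embedding_of_isReal v₀.2 (a' : ↥(maximalRealSubfield L)) / deltaIm (cmPlaceOver L) (imagUnit L) v₀ ≠ 0 :=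
    div_ne_zero ((map_ne_zero _).2 (Units.ne_zero a')) hδ0
  rw [hsign] at hnp hnm
  have key := integer_equations₂ (c := (hμ'.infinityType (cmPlaceOver L v₀).1 + 1) / 2) hκ hpR hmR hnp hnm
  -- read-out: `(σ t).re = Re((σ t)⁻¹) · |σ t|²` and `Im σ(a′(2δ_L)⁻¹) = −ρ(a′)/(2δ)`
  have hN : 0 < Complex.normSq ((cmPlaceOver L v₀).1.embedding t) := Complex.normSq_pos.2 hσt0
  have hτre : ((cmPlaceOver L v₀).1.embedding t).re = τi * Complex.normSq ((cmPlaceOver L v₀).1.embedding t) := by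
    rw [hτi, Complex.inv_re, div_mul_cancel₀ _ hN.ne']
  rw [hτre, im_embedding_cmPlaceOver_mul_inv_two_imagUnit L v₀ (a' : ↥(maximalRealSubfield L))]
  have hkt := mul_pos key hN
  have h4 : τi * Complex.normSq ((cmPlaceOver L v₀).1.embedding t) *
      (-embedding_of_isReal v₀.2 (a' : ↥(maximalRealSubfield L)) / (2 * deltaIm (cmPlaceOver L) (imagUnit L) v₀)) =
      -(embedding_of_isReal v₀.2 (a' : ↥(maximalRealSubfield L)) / deltaIm (cmPlaceOver L) (imagUnit L) v₀ * τi *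
        Complex.normSq ((cmPlaceOver L v₀).1.embedding t)) / 2 := by
    field_simp
  rw [h4]
  linarith

/-! ## §3 The relative corollary over organ (L)'s prefix only -/

set_option maxHeartbeats 1600000 in
/-- **[Liu2021, Lem. D.2 (3)], RELATIVE FORM AT THE PLACE OF `ι`, NO BINDER ON `t` (line LD1, step (L-Dι); ★ `im_mul_im_pos_of_meets_of_hol₂` without
`Im ι(t) = 0`).**  For the letter's field ∕ frame ∕ signature ∕ definiteness ∕ degree data (organ (L)'s prefix Γ), a cone frame `𝔣` of `H` at `cmPlace L ι`, the pinned transport `ιA`, and discrete `P`, `P′` of `U(H)`: if `P` meets the theta lift from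
`⟨a′⟩` and `P′` the one from `⟨a″⟩` at the conjugate-symplectic `λ` along `ιA`, and both are holomorphic-cotangent at `cmPlace L ι` for `𝔣`, then
`0 < Im e♮(a′·(2·imagUnit L)⁻¹) · Im e♮(a″·(2·imagUnit L)⁻¹)`, `e♮ = (cmPlace L ι).1.embedding` — the two lines have THE SAME archimedean sign at `ι`
(§2 twice, for either sign of `Re((e♮ t)⁻¹) ≠ 0`, which the cone frame supplies). [cite: Liu2021, App. D Lem. D.2 (3) (p. 127 L40 – p. 128 L2); proof of Prop. D.4 (1) (p. 131 L27–34)]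
[cite: KonnoKonno2007, Thm. 5.4] -/
theorem im_mul_im_pos_of_meets_of_hol₂' (L : Type) [Field L] [NumberField L] [IsCMField L] (ι : L →+* ℂ) (H : Matrix (Fin 2) (Fin 2) L)
    (dV : Fin 2 → L) (hdV : ∀ i, IsCMField.complexConj L (dV i) = dV i) (hdV0 : ∀ i, dV i ≠ 0)
    (t : L) (ht : t ≠ 0) (g : GL (Fin 2) L)
    (hg : formCongr ((IsCMField.complexConj L : L ≃ₐ[↥(maximalRealSubfield L)] L) : L →+* L) g (t • H) = Matrix.diagonal dV)
    (hT : ∃ T : GL (Fin 2) ℂ, formCongr (starRingEnd ℂ) T ((Matrix.diagonal dV).map ι) = Matrix.diagonal ![(1 : ℂ), -1])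
    (hpos : ∀ τ' : L →+* ℂ, InfinitePlace.mk τ' ≠ InfinitePlace.mk ι → ((Matrix.diagonal dV).map τ').PosDef)
    (h4 : 4 ≤ Module.finrank ℚ L)
    (𝔣 : ConeFrame L H (cmPlace L ι))
    {μ : Measure (adelicGroupData (↥(maximalRealSubfield L)) L (IsCMField.complexConj L) 2 H).automorphicQuotient}
    [(adelicGroupData (↥(maximalRealSubfield L)) L (IsCMField.complexConj L) 2 H).IsAutomorphicMeasure μ]
    {n' : ℕ} (e₁ : Fin 2 × Fin 1 ≃ Fin n')
    (ιA : (adelicGroupData (↥(maximalRealSubfield L)) L (IsCMField.complexConj L) 2 H).Adelic →*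
      ↥(UnitaryGroup.adelic (↥(maximalRealSubfield L)) L (IsCMField.complexConj L) 2 (Matrix.diagonal dV)))
    (hιA : ∀ k, ((ιA k : ↥(UnitaryGroup.adelic (↥(maximalRealSubfield L)) L (IsCMField.complexConj L) 2 (Matrix.diagonal dV))) :
          GL (Fin 2) (AdeleRing (𝓞 L) L)) =
        (toAdeleGL L g)⁻¹ * adelicVal (↥(maximalRealSubfield L)) L (IsCMField.complexConj L) 2 H k * toAdeleGL L g)
    [CompactSpace (↥(UnitaryGroup.adelic (↥(maximalRealSubfield L)) L (IsCMField.complexConj L) 2 (Matrix.diagonal dV)) ⧸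
        (UnitaryGroup.toAdelic (↥(maximalRealSubfield L)) L (IsCMField.complexConj L) 2 (Matrix.diagonal dV)).range)]
    (P P' : DiscreteAutomorphicRep (adelicGroupData (↥(maximalRealSubfield L)) L (IsCMField.complexConj L) 2 H) μ)
    (lam : Literature.NumberTheory.Automorphic.IdeleClassGroup L →ₜ* Circle) (hlam : IsConjugateSymplectic L lam)
    (a' a'' : (↥(maximalRealSubfield L))ˣ)
    (hmeets : MeetsThetaLiftFromLine L 2 H e₁ dV hdV hdV0 P lam hlam a' ιA) (hmeets' : MeetsThetaLiftFromLine L 2 H e₁ dV hdV hdV0 P' lam hlam a'' ιA)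
    (hhol : P.IsHolCotangentAt₂ (IsCMField.complexConj_ne_one L) (UnitaryGroup.complexConj_smul_infinitePlace L) (cmPlace L ι) 𝔣)
    (hhol' : P'.IsHolCotangentAt₂ (IsCMField.complexConj_ne_one L) (UnitaryGroup.complexConj_smul_infinitePlace L) (cmPlace L ι) 𝔣) :
    0 < ((cmPlace L ι).1.embedding (algebraMap (↥(maximalRealSubfield L)) L a' * (2 * imagUnit L)⁻¹)).im *
      ((cmPlace L ι).1.embedding (algebraMap (↥(maximalRealSubfield L)) L a'' * (2 * imagUnit L)⁻¹)).im := by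
  haveI : CompactSpace (adelicGroupData (↥(maximalRealSubfield L)) L (IsCMField.complexConj L) 2 H).automorphicQuotient := by
    obtain ⟨τ, hτ⟩ := UnitaryGroup.exists_infinitePlace_ne L h4 ι
    exact UnitaryGroup.compactSpace_adelicGroupData_automorphicQuotient L 2 H
      (UnitaryGroup.anisotropic_of_formCongr_smul_eq_of_posDef L 2 H dV t ht g hg τ (hpos τ hτ))
  let v₀ : {v : InfinitePlace (↥(maximalRealSubfield L)) // v.IsReal} :=
    ⟨(InfinitePlace.mk ι).comap (algebraMap (↥(maximalRealSubfield L)) L),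
      Literature.NumberTheory.GelbartRogawski1991.UnitaryDualPair.ArchSplitting.QuadExt.isReal_comap_of_smul_eq (F := ↥(maximalRealSubfield L))
        (E := L) (c := IsCMField.complexConj L) (w := ⟨InfinitePlace.mk ι, IsTotallyComplex.isComplex _⟩) (UnitaryGroup.complexConj_smul_infinitePlace L _)
        (IsCMField.complexConj_ne_one L)⟩
  have hw₀ : (cmPlaceOver L v₀).1 = InfinitePlace.mk ι := comap_injective_of_isCMField (L := L) (cmPlaceOver_comap L v₀)
  have hv₀ : cmPlace L ι = cmPlaceOver L v₀ := (Subtype.ext hw₀).symm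
  -- `e♮(dV p) = ι(dV p)` is real; the phase-robust sign `τi = Re((e♮ t)⁻¹) ≠ 0` (from the cone frame)
  have hdVim : ∀ p, (ι (dV p)).im = 0 := fun p => by
    have h1 : ι (cmConjRingHom L (dV p)) = starRingEnd ℂ (ι (dV p)) := embedding_cmConjRingHom L ι (dV p)
    have h2 : cmConjRingHom L (dV p) = dV p := hdV p
    rw [h2] at h1
    exact Complex.conj_eq_iff_im.1 h1.symm
  have hedV : ∀ p, (cmPlace L ι).1.embedding (dV p) = (((ι (dV p)).re : ℝ) : ℂ) := fun p => by
    rw [embedding_cmPlace_apply_of_im_eq_zero L ι (dV p) (hdVim p)]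
    exact Complex.ext (by simp) (by simp [hdVim p])
  set τi : ℝ := (((cmPlace L ι).1.embedding t)⁻¹).re with hτi
  have hτi0 : τi ≠ 0 := re_inv_embedding_ne_zero_of_coneFrame L H dV hdV t ht g hg (cmPlace L ι) 𝔣
  have hre : ∀ p, ((cmPlace L ι).1.embedding (dV p) * ((cmPlace L ι).1.embedding t)⁻¹).re = (ι (dV p)).re * τi := fun p => by
    rw [hedV, Complex.re_ofReal_mul]
  -- the signature gives a negative and a positive `ι(dV p)`; the frame signs for EITHER sign of `τi`
  obtain ⟨T, hT'⟩ := hT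
  rw [Matrix.diagonal_map (map_zero ι)] at hT'
  obtain ⟨qm, qp, hne, hqm, hqp⟩ := exists_neg_pos_of_sig₂ (fun p => ι (dV p)) T hT'
  obtain ⟨pm, pp, hne', hm, hp⟩ : ∃ pm pp : Fin 2, pp ≠ pm ∧
      ((cmPlace L ι).1.embedding (dV pm) * ((cmPlace L ι).1.embedding t)⁻¹).re < 0 ∧
      0 < ((cmPlace L ι).1.embedding (dV pp) * ((cmPlace L ι).1.embedding t)⁻¹).re := by
    rcases lt_or_gt_of_ne hτi0 with hτ_neg | hτ_pos
    · refine ⟨qp, qm, hne.symm, ?_, ?_⟩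
      · rw [hre]; exact mul_neg_of_pos_of_neg hqp hτ_neg
      · rw [hre]; exact mul_pos_of_neg_of_neg hqm hτ_neg
    · refine ⟨qm, qp, hne, ?_, ?_⟩
      · rw [hre]; exact mul_neg_of_neg_of_pos hqm hτ_pos
      · rw [hre]; exact mul_pos hqp hτ_pos
  have k1 := re_mul_im_lt_zero_of_meets_of_hol₂' L H dV hdV hdV0 t ht g hg v₀ (cmPlace L ι) hv₀ pm pp hne' hm hp 𝔣 e₁ ιA hιA P lam hlam a'
    hmeets hhol
  have k2 := re_mul_im_lt_zero_of_meets_of_hol₂' L H dV hdV hdV0 t ht g hg v₀ (cmPlace L ι) hv₀ pm pp hne' hm hp 𝔣 e₁ ιA hιA P' lam hlam a''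
    hmeets' hhol'
  have k3 := mul_pos_of_neg_of_neg k1 k2
  have hr2 : 0 < ((cmPlace L ι).1.embedding t).re * ((cmPlace L ι).1.embedding t).re := by
    have hr0 : ((cmPlace L ι).1.embedding t).re ≠ 0 := fun h0 => hτi0 (by rw [hτi, Complex.inv_re, h0, zero_div])
    exact mul_self_pos.2 hr0
  nlinarith [k3, hr2]

end Summit.HodgeConjecture.HodgeConjecture.Cruxes.HLiu418.F0LD2ArchSignAtAnyPhase

end
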